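import Literature.IUT.HodgeArakelov.GaloisPairCyclotomesCor111GenuineOfSetting
import Literature.IUT.HodgeArakelov.GaloisPairCyclotomesThetaSyncThetaSide
import HarnessLib

/-!
# [IUTchII] Cor. 1.11 with ALL inputs GENUINE — modulo (C) ALONE (proof-only corollary)

Mochizuki, *Inter-universal Teichmüller theory II*, §1, Cor. 1.11, kurims manuscript (Dec. 2020) p. 49
[claim: Mochizuki2012, status: disputed] (IUTchII §1 Cor 1.11, kurims p.49). abc-iut cell, layer L6, node `IUTchII:Cor1.11`;
seat abc-iut-w5-d145 (gens 3–4). abc-iut-w4-d030's `EtaleLevels.exists_cor111FunctorCor110_familyLim_multiradiallyDefined_of_base`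
(`GaloisPairCyclotomesCor111Genuine`) gives the Cor. 1.11 functor over Cor. 1.10's GENUINE family `familyLim` at the GENUINE
monoids / twist / rigidity input, GIVEN the (E)+(C) datum `(c, hE, hC')` at `Π₀`. By abc-iut-w5-d145's
`EtaleLevels.exists_equivariant_iso` (`GaloisPairCyclotomesThetaSyncThetaSide`, p432181: (E) HOLDS — LCFT at `ℚ_p` +
«`(l·Δ_Θ)(𝕄_*) ≅ Ẑ(1)` as a `G_K`-module» from the family's own binders) the datum reduces to (C) alone:
* `EtaleLevels.exists_cor111FunctorCor110_familyLim_multiradiallyDefined_of_compatible` — hypothesis: (C) for EVERY iso;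
* `…_of_exists_compatible` — hypothesis: (C) for SOME iso ((C) is iso-independent, p428581);
* `…_of_compatible_ownField` / `…_of_exists_compatible_ownField` — the same over the setting's OWN base field `K ⊆ ℚ̄_p`
  with `ε := TemperedCurve.galoisEpsilon` (abc-iut-w5-d233's `…_of_base_ownField`, `GaloisPairCyclotomesCor111GenuineOfSetting`,
  p433665): NO model-identification binder `(k, ε)` left; residual = (H1) `hΔ`, (H2) `hq`, (C).
(C) = [AbsTopIII] Cor. 1.10 (c) NATURALITY composed with [EtTh] Cor. 2.19 (i) (GAP-LEDGER G-w5d145-2). PROOF-ONLY, 0 defs;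
nothing of another seat restated; nothing here bears on [IUTchIII] Cor. 3.12; typed ≠ discharged.
-/

noncomputable section

namespace Literature.IUT.HodgeArakelov

open CategoryTheory
open Literature.AnabelianGeometry.AbsoluteAnabelian

namespace EtaleLevels

open Literature.AnabelianGeometry.EtaleTheta Literature.AnabelianGeometry.SemiGraphs
open scoped Literature.AnabelianGeometry.EtaleTheta

variable {p : ℕ} [Fact p.Prime] {D : Literature.AnabelianGeometry.EtaleTheta.ThetaSetting p}
  {E : D.EtaleThetaData} {l : ℕ} (C : E.DoubleUnderline l) (hC : D.Compat) (hS : D.Sec2Hyps)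
  (hl : l.Prime) (hp2 : p ≠ 2) (hpl : p ≠ l) (hζ : ∃ ζ : D.K, IsPrimitiveRoot ζ (4 * l))
  (mods : ∀ M : ℕ+, D.CyclotomeMod l M)
  (f : contCocycles D.toTheta D.DeltaTheta C.GtpYdduu) (hf : f ∈ C.rootCocycles hC)
  (hmods : ∀ (M M' : ℕ+) (h : (M : ℕ) ∣ (M' : ℕ)) (x : D.lDeltaTheta l),
    MuN.red p M M' h ((mods M').red x) = (mods M).red x)
  (h15 : Literature.AnabelianGeometry.EtaleTheta.ThetaSetting.Prop15iii E hC) (L : C.CuspLabels)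
  (hZ : ∀ M : ℕ+, Nonempty (ModelCyclotomes.lDeltaQuot (C.rigidData (mods M) hC hS h15 L) ≃*
    Literature.IUT.HodgeTheaters.ZHat))
  (h218i₁ : (levelRigid C hC hS mods h15 L 1).Cor218_i)
  (k : Type) [Field k] [CharZero k] [ValuativeRel k] [TopologicalSpace k] [IsNonarchimedeanLocalField k]
  [CompactSpace (setting C hC hS hl hp2 hpl hζ mods f hf).Gk]
  (ε : (setting C hC hS hl hp2 hpl hζ mods f hf).Gk ≃ₜ*
    (ModelMLFGaloisData.galois (MLFClosure.std k).k (MLFClosure.std k).K).tmPair.Pi)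
  (hΔ : ∀ g : (setting C hC hS hl hp2 hpl hζ mods f hf).PiX ≃ₜ* (setting C hC hS hl hp2 hpl hζ mods f hf).PiX,
    (setting C hC hS hl hp2 hpl hζ mods f hf).DeltaX.map g.toMulEquiv.toMonoidHom =
      (setting C hC hS hl hp2 hpl hζ mods f hf).DeltaX)
  (hq : Nonempty (TopGroup.quot (setting C hC hS hl hp2 hpl hζ mods f hf).PiX
    (setting C hC hS hl hp2 hpl hζ mods f hf).DeltaX ≃ₜ* (setting C hC hS hl hp2 hpl hζ mods f hf).Gk))

/-- **[IUTchII] Cor. 1.11 with ALL inputs GENUINE, modulo (C) alone**: over the [EtTh]-model setting, with the GENUINE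
monoids `genuineOfModel`, the GENUINE `Ẑ^×`-twist, the UNCONDITIONAL rigidity input (a) and Cor. 1.10's GENUINE family
`familyLim`, the Cor. 1.11 functor `ℛ → ℱ` EXISTS and is multiradially defined as soon as (C) holds: EVERY isomorphism
`μ_Ẑ(Π^tp_{X̲̲}/Δ) ⥲ (l·Δ_Θ)(𝕄_*)` intertwines `μ_Ẑ(quotMap γ)` with `ρ_A(γ)` for every topological automorphism `γ` of `Π^tp_{X̲̲}`
([AbsTopIII] Cor. 1.10 (c) naturality ∘ [EtTh] Cor. 2.19 (i); GAP-LEDGER G-w5d145-2). The (E) half of the datum is the theorem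
`EtaleLevels.exists_equivariant_iso`. [claim: Mochizuki2012, status: disputed] (IUTchII §1 Cor 1.11, kurims p.49) -/
theorem exists_cor111FunctorCor110_familyLim_multiradiallyDefined_of_compatible
    (hC' : ∀ (c : ↥((AbsTopMonoids.genuineOfModel (setting C hC hS hl hp2 hpl hζ mods f hf) (MLFClosure.std k) ε hΔ hq).quotObj
          (basePointLim C hC hS hl hp2 hpl hζ mods f hf hmods h15 L hZ)).galCyclotome ≃*
        (baseDatumLim C hC hS hl hp2 hpl hζ mods f hf hmods h15 L hZ h218i₁).A)
      (γ : basePointLim C hC hS hl hp2 hpl hζ mods f hf hmods h15 L hZ ⟶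
          basePointLim C hC hS hl hp2 hpl hζ mods f hf hmods h15 L hZ)
      (ζ : ((AbsTopMonoids.genuineOfModel (setting C hC hS hl hp2 hpl hζ mods f hf) (MLFClosure.std k) ε hΔ hq).quotObj
          (basePointLim C hC hS hl hp2 hpl hζ mods f hf hmods h15 L hZ)).galCyclotome),
      c (IsoClass.galCyclotomeMap
          ((AbsTopMonoids.genuineOfModel (setting C hC hS hl hp2 hpl hζ mods f hf) (MLFClosure.std k) ε hΔ hq).quotMap γ) ζ) =
        (baseDatumLim C hC hS hl hp2 hpl hζ mods f hf hmods h15 L hZ h218i₁).rhoA (IsoClass.homIso γ) (c ζ))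
    (Γ : Subgroup ZHatUnits) (Γ' : Type) [Group Γ'] :
    ∃ (R : GalRigidityInput
        (AbsTopMonoids.genuineOfModel (setting C hC hS hl hp2 hpl hζ mods f hf) (MLFClosure.std k) ε hΔ hq))
      (I : GalCorPiXInput
        (AbsTopMonoids.genuineOfModel (setting C hC hS hl hp2 hpl hζ mods f hf) (MLFClosure.std k) ε hΔ hq)
        (familyLim C hC hS hl hp2 hpl hζ mods f hf hmods h15 L hZ h218i₁)),
      ((ex18iii (setting C hC hS hl hp2 hpl hζ mods f hf) Γ').toDagger
        (cor111FunctorCor110 (GalTwistInput.ofZHat (setting C hC hS hl hp2 hpl hζ mods f hf)) R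
          (familyLim C hC hS hl hp2 hpl hζ mods f hf hmods h15 L hZ h218i₁) I Γ Γ')).IsMultiradiallyDefined := by
  obtain ⟨c, hE⟩ := exists_equivariant_iso C hC hS hl hp2 hpl hζ mods f hf hmods h15 L hZ h218i₁
    (AbsTopMonoids.genuineOfModel (setting C hC hS hl hp2 hpl hζ mods f hf) (MLFClosure.std k) ε hΔ hq)
  exact exists_cor111FunctorCor110_familyLim_multiradiallyDefined_of_base C hC hS hl hp2 hpl hζ mods f hf hmods h15 L hZ
    h218i₁ k ε hΔ hq c hE (hC' c) Γ Γ'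

/-- The same with (C) assumed for SOME isomorphism only ((C) does not depend on the isomorphism:
`GalCorPiXInput.compatible_transfer`, p428581). [claim: Mochizuki2012, status: disputed] (IUTchII §1 Cor 1.11, kurims p.49) -/
theorem exists_cor111FunctorCor110_familyLim_multiradiallyDefined_of_exists_compatible
    (hC' : ∃ c : ↥((AbsTopMonoids.genuineOfModel (setting C hC hS hl hp2 hpl hζ mods f hf) (MLFClosure.std k) ε hΔ hq).quotObj
          (basePointLim C hC hS hl hp2 hpl hζ mods f hf hmods h15 L hZ)).galCyclotome ≃*
        (baseDatumLim C hC hS hl hp2 hpl hζ mods f hf hmods h15 L hZ h218i₁).A,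
      ∀ (γ : basePointLim C hC hS hl hp2 hpl hζ mods f hf hmods h15 L hZ ⟶
          basePointLim C hC hS hl hp2 hpl hζ mods f hf hmods h15 L hZ)
        (ζ : ((AbsTopMonoids.genuineOfModel (setting C hC hS hl hp2 hpl hζ mods f hf) (MLFClosure.std k) ε hΔ hq).quotObj
          (basePointLim C hC hS hl hp2 hpl hζ mods f hf hmods h15 L hZ)).galCyclotome),
        c (IsoClass.galCyclotomeMap
            ((AbsTopMonoids.genuineOfModel (setting C hC hS hl hp2 hpl hζ mods f hf) (MLFClosure.std k) ε hΔ hq).quotMap γ) ζ) =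
          (baseDatumLim C hC hS hl hp2 hpl hζ mods f hf hmods h15 L hZ h218i₁).rhoA (IsoClass.homIso γ) (c ζ))
    (Γ : Subgroup ZHatUnits) (Γ' : Type) [Group Γ'] :
    ∃ (R : GalRigidityInput
        (AbsTopMonoids.genuineOfModel (setting C hC hS hl hp2 hpl hζ mods f hf) (MLFClosure.std k) ε hΔ hq))
      (I : GalCorPiXInput
        (AbsTopMonoids.genuineOfModel (setting C hC hS hl hp2 hpl hζ mods f hf) (MLFClosure.std k) ε hΔ hq)
        (familyLim C hC hS hl hp2 hpl hζ mods f hf hmods h15 L hZ h218i₁)),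
      ((ex18iii (setting C hC hS hl hp2 hpl hζ mods f hf) Γ').toDagger
        (cor111FunctorCor110 (GalTwistInput.ofZHat (setting C hC hS hl hp2 hpl hζ mods f hf)) R
          (familyLim C hC hS hl hp2 hpl hζ mods f hf hmods h15 L hZ h218i₁) I Γ Γ')).IsMultiradiallyDefined := by
  obtain ⟨c, hc⟩ := hC'
  have hA := nonempty_baseDatumLim_A_mulEquiv_zHat C hC hS hl hp2 hpl hζ mods f hf hmods h15 L hZ h218i₁
  exact exists_cor111FunctorCor110_familyLim_multiradiallyDefined_of_compatible C hC hS hl hp2 hpl hζ mods f hf hmods h15 L hZ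
    h218i₁ k ε hΔ hq (fun c' => GalCorPiXInput.compatible_transfer _ _ hA c c' hc) Γ Γ'

/-- **[IUTchII] Cor. 1.11 with ALL inputs GENUINE over the setting's OWN base field `K`, modulo (C) alone**: abc-iut-w5-d233's
`exists_cor111FunctorCor110_familyLim_multiradiallyDefined_of_base_ownField` (`k := K ⊆ ℚ̄_p`, `ε := TemperedCurve.galoisEpsilon`)
with its (E) hypothesis DISCHARGED by `EtaleLevels.exists_equivariant_iso`; the only residual beyond (H1) `hΔ` / (H2) `hq` is (C)
for EVERY isomorphism `μ_Ẑ(Π^tp_{X̲̲}/Δ) ⥲ (l·Δ_Θ)(𝕄_*)` (GAP-LEDGER G-w5d145-2).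
[claim: Mochizuki2012, status: disputed] (IUTchII §1 Cor 1.11, kurims p.49) -/
theorem exists_cor111FunctorCor110_familyLim_multiradiallyDefined_of_compatible_ownField
    (hC' : ∀ (c : ↥((AbsTopMonoids.genuineOfModel (setting C hC hS hl hp2 hpl hζ mods f hf) D.toTemperedCurve.mlfClosure
            D.toTemperedCurve.galoisEpsilon hΔ hq).quotObj
          (basePointLim C hC hS hl hp2 hpl hζ mods f hf hmods h15 L hZ)).galCyclotome ≃*
        (baseDatumLim C hC hS hl hp2 hpl hζ mods f hf hmods h15 L hZ h218i₁).A)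
      (γ : basePointLim C hC hS hl hp2 hpl hζ mods f hf hmods h15 L hZ ⟶
          basePointLim C hC hS hl hp2 hpl hζ mods f hf hmods h15 L hZ)
      (ζ : ((AbsTopMonoids.genuineOfModel (setting C hC hS hl hp2 hpl hζ mods f hf) D.toTemperedCurve.mlfClosure
            D.toTemperedCurve.galoisEpsilon hΔ hq).quotObj
          (basePointLim C hC hS hl hp2 hpl hζ mods f hf hmods h15 L hZ)).galCyclotome),
      c (IsoClass.galCyclotomeMap
          ((AbsTopMonoids.genuineOfModel (setting C hC hS hl hp2 hpl hζ mods f hf) D.toTemperedCurve.mlfClosure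
            D.toTemperedCurve.galoisEpsilon hΔ hq).quotMap γ) ζ) =
        (baseDatumLim C hC hS hl hp2 hpl hζ mods f hf hmods h15 L hZ h218i₁).rhoA (IsoClass.homIso γ) (c ζ))
    (Γ : Subgroup ZHatUnits) (Γ' : Type) [Group Γ'] :
    ∃ (R : GalRigidityInput
        (AbsTopMonoids.genuineOfModel (setting C hC hS hl hp2 hpl hζ mods f hf) D.toTemperedCurve.mlfClosure
          D.toTemperedCurve.galoisEpsilon hΔ hq))
      (I : GalCorPiXInput
        (AbsTopMonoids.genuineOfModel (setting C hC hS hl hp2 hpl hζ mods f hf) D.toTemperedCurve.mlfClosure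
          D.toTemperedCurve.galoisEpsilon hΔ hq)
        (familyLim C hC hS hl hp2 hpl hζ mods f hf hmods h15 L hZ h218i₁)),
      ((ex18iii (setting C hC hS hl hp2 hpl hζ mods f hf) Γ').toDagger
        (cor111FunctorCor110 (GalTwistInput.ofZHat (setting C hC hS hl hp2 hpl hζ mods f hf)) R
          (familyLim C hC hS hl hp2 hpl hζ mods f hf hmods h15 L hZ h218i₁) I Γ Γ')).IsMultiradiallyDefined := by
  obtain ⟨c, hE⟩ := exists_equivariant_iso C hC hS hl hp2 hpl hζ mods f hf hmods h15 L hZ h218i₁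
    (AbsTopMonoids.genuineOfModel (setting C hC hS hl hp2 hpl hζ mods f hf) D.toTemperedCurve.mlfClosure
      D.toTemperedCurve.galoisEpsilon hΔ hq)
  exact exists_cor111FunctorCor110_familyLim_multiradiallyDefined_of_base_ownField C hC hS hl hp2 hpl hζ mods f hf hmods
    h15 L hZ h218i₁ hΔ hq c hE (hC' c) Γ Γ'

/-- The own-field version with (C) assumed for SOME isomorphism only ((C) is iso-independent:
`GalCorPiXInput.compatible_transfer`, p428581). [claim: Mochizuki2012, status: disputed] (IUTchII §1 Cor 1.11, kurims p.49) -/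
theorem exists_cor111FunctorCor110_familyLim_multiradiallyDefined_of_exists_compatible_ownField
    (hC' : ∃ c : ↥((AbsTopMonoids.genuineOfModel (setting C hC hS hl hp2 hpl hζ mods f hf) D.toTemperedCurve.mlfClosure
            D.toTemperedCurve.galoisEpsilon hΔ hq).quotObj
          (basePointLim C hC hS hl hp2 hpl hζ mods f hf hmods h15 L hZ)).galCyclotome ≃*
        (baseDatumLim C hC hS hl hp2 hpl hζ mods f hf hmods h15 L hZ h218i₁).A,
      ∀ (γ : basePointLim C hC hS hl hp2 hpl hζ mods f hf hmods h15 L hZ ⟶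
          basePointLim C hC hS hl hp2 hpl hζ mods f hf hmods h15 L hZ)
        (ζ : ((AbsTopMonoids.genuineOfModel (setting C hC hS hl hp2 hpl hζ mods f hf) D.toTemperedCurve.mlfClosure
            D.toTemperedCurve.galoisEpsilon hΔ hq).quotObj
          (basePointLim C hC hS hl hp2 hpl hζ mods f hf hmods h15 L hZ)).galCyclotome),
        c (IsoClass.galCyclotomeMap
            ((AbsTopMonoids.genuineOfModel (setting C hC hS hl hp2 hpl hζ mods f hf) D.toTemperedCurve.mlfClosure
              D.toTemperedCurve.galoisEpsilon hΔ hq).quotMap γ) ζ) =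
          (baseDatumLim C hC hS hl hp2 hpl hζ mods f hf hmods h15 L hZ h218i₁).rhoA (IsoClass.homIso γ) (c ζ))
    (Γ : Subgroup ZHatUnits) (Γ' : Type) [Group Γ'] :
    ∃ (R : GalRigidityInput
        (AbsTopMonoids.genuineOfModel (setting C hC hS hl hp2 hpl hζ mods f hf) D.toTemperedCurve.mlfClosure
          D.toTemperedCurve.galoisEpsilon hΔ hq))
      (I : GalCorPiXInput
        (AbsTopMonoids.genuineOfModel (setting C hC hS hl hp2 hpl hζ mods f hf) D.toTemperedCurve.mlfClosure
          D.toTemperedCurve.galoisEpsilon hΔ hq)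
        (familyLim C hC hS hl hp2 hpl hζ mods f hf hmods h15 L hZ h218i₁)),
      ((ex18iii (setting C hC hS hl hp2 hpl hζ mods f hf) Γ').toDagger
        (cor111FunctorCor110 (GalTwistInput.ofZHat (setting C hC hS hl hp2 hpl hζ mods f hf)) R
          (familyLim C hC hS hl hp2 hpl hζ mods f hf hmods h15 L hZ h218i₁) I Γ Γ')).IsMultiradiallyDefined := by
  obtain ⟨c, hc⟩ := hC'
  have hA := nonempty_baseDatumLim_A_mulEquiv_zHat C hC hS hl hp2 hpl hζ mods f hf hmods h15 L hZ h218i₁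
  exact exists_cor111FunctorCor110_familyLim_multiradiallyDefined_of_compatible_ownField C hC hS hl hp2 hpl hζ mods f hf
    hmods h15 L hZ h218i₁ hΔ hq (fun c' => GalCorPiXInput.compatible_transfer _ _ hA c c' hc) Γ Γ'

end EtaleLevels

end Literature.IUT.HodgeArakelov

end
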